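import Summits.Ventures.PercRepro.RankLevelSetRuleQSliceStep

/-!
# PercRepro — THE DIAGONAL SLICE SUMS `S_j(Q, Q)` IN CLOSED FORM, UNIFORMLY IN `Q`, AND THE MONOTONICITY OF THE SLICE SUMS
(night-1, gen 20; dossier §31)

The slice sums `S_j(Q, m) = Σ_{a ≤ m} C(m, a)/C(Q+j+a, a+j)` carry the untruncated part of `R̂(q, k, m)`
(`rhatSliceL_le_rhat`). This module records, uniformly in `Q` (no family `k` is fixed):
* **monotonicity** — `S_j(Q, m)` is nondecreasing in `m` (Pascal in the slice sums, `rhatSliceSum_succ`: `slice_mono_m`)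
  and nonincreasing in `j` (the slice step `slice_sum_step`: `slice_anti_j`, `slice_le_three`);
* **the diagonal `m = Q` in closed form**, through the exact half rows `2Q`, `2Q+1`, `2Q+2`
  (`sum_range_choose_half_zero`, `Nat.sum_range_choose_halfway`) with `X = 4^Q/C(2Q, Q)`:
  `S₁(Q, Q) = 1/2 + X/(2(2Q+1))` (`slice_one_diag`), `S₁(Q+1, Q) = 1/2` (`slice_one_succ_diag`),
  `S₂(Q, Q) = 1/(2(Q+1)) + X/(2(2Q+1))` (`slice_two_diag`), `S₁(Q+2, Q)` and `S₂(Q+1, Q) = X_{Q+1}/(2(2Q+3))`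
  (`slice_one_succ2_diag`, `slice_two_succ_diag`), `S₃(Q, Q) = 1/(2(Q+1)) + 3X/(2(2Q+1)(2Q+3))` (`slice_three_diag`);
* **the Wallis upper bound** `X² ≤ 4Q` (`xq_sq_le`, from `centralBinom_sq_mul_ge`) in the two forms used downstream:
  `S₃(Q, Q) ≤ 1/Q` (`slice_three_diag_le`) and `X·E ≤ 2Q + 1` whenever `E² ≤ Q` (`xq_mul_le`).
Hence `S₁(Q, m) ≤ 1/2 + X/(2(2Q+1))`, `S₂(Q, m) ≤ 1/(2(Q+1)) + X/(2(2Q+1))` and `S_j(Q, m) ≤ 1/Q` (`j ≥ 3`) for EVERY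
`m ≤ Q` — the uniform bounds behind RankLevelSetRuleQSliceNegAll (the negative half of the slice map for every `k`).
Twin: mining/night-1/g20/negall_twin.py (the closed forms and bounds exact on `Q ≤ 60`). Axioms: standard.
-/

namespace PercRepro

open Finset

/-! ### §1 The diagonal slice sums in closed form, uniform in `Q` -/

/-- **`S₁(Q+1, Q) = 1/2`** (`slice_sum_one_eq` at `q = m + 1`: the row term vanishes). -/
lemma slice_one_succ_diag (Q : ℕ) :
    ∑ a ∈ range (Q + 1), (Q.choose a : ℚ) / ((Q + 1 + 1 + a).choose (a + 1) : ℚ) = 1 / 2 := by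
  rw [slice_sum_one_eq (Q + 1) Q]
  have hC : (0 : ℚ) < ((Q + 1 + Q).choose Q : ℚ) := by exact_mod_cast Nat.choose_pos (by omega)
  push_cast
  field_simp
  ring

/-- **`S₁(Q, Q) = 1/2 + X/(2(2Q+1))`**, `X = 4^Q/C(2Q, Q)` (the even half row `2Q`). -/
lemma slice_one_diag (Q : ℕ) :
    ∑ a ∈ range (Q + 1), (Q.choose a : ℚ) / ((Q + 1 + a).choose (a + 1) : ℚ)
      = 1 / 2 + ((4 : ℚ) ^ Q / ((2 * Q).choose Q : ℚ)) / (2 * (2 * (Q : ℚ) + 1)) := by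
  rw [slice_sum_one_eq Q Q, show Q + Q = 2 * Q by ring]
  have hC : (0 : ℚ) < ((2 * Q).choose Q : ℚ) := by exact_mod_cast Nat.choose_pos (by omega)
  have hh : 2 * ∑ i ∈ range Q, ((2 * Q).choose i : ℚ) + ((2 * Q).choose Q : ℚ) = (4 : ℚ) ^ Q := by
    exact_mod_cast sum_range_choose_half_zero Q
  rw [← hh]
  field_simp
  ring

/-- **`S₂(Q, Q) = 1/(2(Q+1)) + X/(2(2Q+1))`** (the slice step at `j = 1` on the diagonal). -/
lemma slice_two_diag (Q : ℕ) :
    ∑ a ∈ range (Q + 1), (Q.choose a : ℚ) / ((Q + 2 + a).choose (a + 2) : ℚ)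
      = 1 / (2 * ((Q : ℚ) + 1)) + ((4 : ℚ) ^ Q / ((2 * Q).choose Q : ℚ)) / (2 * (2 * (Q : ℚ) + 1)) := by
  have h := slice_sum_step Q Q 1
  simp only [show (1 : ℕ) + 1 = 2 from rfl] at h
  rw [h, slice_one_diag, slice_one_succ_diag]
  have hC : (0 : ℚ) < ((2 * Q).choose Q : ℚ) := by exact_mod_cast Nat.choose_pos (by omega)
  field_simp
  ring

/-- **`S₁(Q+2, Q) = (Q+2)(2Q+3 − Y)/(2(Q+1)(2Q+3))`**, `Y = 4^{Q+1}/C(2Q+2, Q+1)` (the even half row `2Q+2`). -/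
lemma slice_one_succ2_diag (Q : ℕ) :
    ∑ a ∈ range (Q + 1), (Q.choose a : ℚ) / ((Q + 2 + 1 + a).choose (a + 1) : ℚ)
      = ((Q : ℚ) + 2) * (2 * (Q : ℚ) + 3 - (4 : ℚ) ^ (Q + 1) / ((2 * Q + 2).choose (Q + 1) : ℚ))
        / (2 * ((Q : ℚ) + 1) * (2 * (Q : ℚ) + 3)) := by
  rw [slice_sum_one_eq (Q + 2) Q, show Q + 2 + Q = 2 * Q + 2 by ring]
  have hhalf := sum_range_choose_half_zero (Q + 1)
  rw [show 2 * (Q + 1) = 2 * Q + 2 by ring, Finset.sum_range_succ] at hhalf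
  have hh : 2 * (∑ i ∈ range Q, ((2 * Q + 2).choose i : ℚ) + ((2 * Q + 2).choose Q : ℚ))
      + ((2 * Q + 2).choose (Q + 1) : ℚ) = (4 : ℚ) ^ (Q + 1) := by exact_mod_cast hhalf
  have hB : ((2 * Q + 2).choose (Q + 1) : ℚ) * ((Q : ℚ) + 1) = ((2 * Q + 2).choose Q : ℚ) * ((Q : ℚ) + 2) := by
    have h := Nat.choose_succ_right_eq (2 * Q + 2) Q
    rw [show 2 * Q + 2 - Q = Q + 2 by omega] at h
    exact_mod_cast h
  have hC : (0 : ℚ) < ((2 * Q + 2).choose Q : ℚ) := by exact_mod_cast Nat.choose_pos (by omega)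
  have hB' : ((2 * Q + 2).choose (Q + 1) : ℚ) = ((2 * Q + 2).choose Q : ℚ) * ((Q : ℚ) + 2) / ((Q : ℚ) + 1) := by
    rw [eq_div_iff (by positivity)]; exact hB
  rw [← hh, hB']
  push_cast
  field_simp
  ring

/-- **`S₂(Q+1, Q) = Y/(2(2Q+3))`**, `Y = 4^{Q+1}/C(2Q+2, Q+1)`. -/
lemma slice_two_succ_diag (Q : ℕ) :
    ∑ a ∈ range (Q + 1), (Q.choose a : ℚ) / ((Q + 1 + 2 + a).choose (a + 2) : ℚ)
      = ((4 : ℚ) ^ (Q + 1) / ((2 * Q + 2).choose (Q + 1) : ℚ)) / (2 * (2 * (Q : ℚ) + 3)) := by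
  have h := slice_sum_step (Q + 1) Q 1
  simp only [show (1 : ℕ) + 1 = 2 from rfl] at h
  rw [h, slice_one_succ_diag]
  have hre : ∑ a ∈ range (Q + 1), (Q.choose a : ℚ) / ((Q + 1 + 1 + 1 + a).choose (a + 1) : ℚ)
      = ∑ a ∈ range (Q + 1), (Q.choose a : ℚ) / ((Q + 2 + 1 + a).choose (a + 1) : ℚ) :=
    Finset.sum_congr rfl (fun a _ => by rw [show Q + 1 + 1 + 1 + a = Q + 2 + 1 + a by ring])
  rw [hre, slice_one_succ2_diag]
  have hB : (0 : ℚ) < ((2 * Q + 2).choose (Q + 1) : ℚ) := by exact_mod_cast Nat.choose_pos (by omega)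
  push_cast
  field_simp
  ring

/-- **`S₃(Q, Q) = 1/(2(Q+1)) + 3X/(2(2Q+1)(2Q+3))`** (the slice step at `j = 2`; `(Q+1)·C(2Q+2, Q+1) = 2(2Q+1)·C(2Q, Q)`). -/
lemma slice_three_diag (Q : ℕ) :
    ∑ a ∈ range (Q + 1), (Q.choose a : ℚ) / ((Q + 3 + a).choose (a + 3) : ℚ)
      = 1 / (2 * ((Q : ℚ) + 1))
        + 3 * ((4 : ℚ) ^ Q / ((2 * Q).choose Q : ℚ)) / (2 * (2 * (Q : ℚ) + 1) * (2 * (Q : ℚ) + 3)) := by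
  have h := slice_sum_step Q Q 2
  simp only [show (2 : ℕ) + 1 = 3 from rfl] at h
  rw [h, slice_two_diag, slice_two_succ_diag]
  have hY : ((2 * Q + 2).choose (Q + 1) : ℚ) * ((Q : ℚ) + 1) = 2 * (2 * (Q : ℚ) + 1) * ((2 * Q).choose Q : ℚ) := by
    have h := Nat.succ_mul_centralBinom_succ Q
    rw [Nat.centralBinom_eq_two_mul_choose, Nat.centralBinom_eq_two_mul_choose,
      show 2 * (Q + 1) = 2 * Q + 2 by ring] at h
    have h' : ((Q + 1 : ℕ) : ℚ) * ((2 * Q + 2).choose (Q + 1) : ℚ)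
        = ((2 * (2 * Q + 1) : ℕ) : ℚ) * ((2 * Q).choose Q : ℚ) := by exact_mod_cast h
    push_cast at h'
    linear_combination h'
  have hC : (0 : ℚ) < ((2 * Q).choose Q : ℚ) := by exact_mod_cast Nat.choose_pos (by omega)
  have hB : ((2 * Q + 2).choose (Q + 1) : ℚ) = 2 * (2 * (Q : ℚ) + 1) * ((2 * Q).choose Q : ℚ) / ((Q : ℚ) + 1) := by
    rw [eq_div_iff (by positivity)]; exact hY
  rw [hB]
  field_simp
  ring

/-! ### §2 Monotonicity of the slice sums: nondecreasing in `m`, nonincreasing in `j` -/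

/-- **`S_j(Q, m)` is nondecreasing in `m`** (Pascal in the slice sums, `rhatSliceSum_succ`). -/
lemma slice_mono_m (Q j : ℕ) {m m' : ℕ} (h : m ≤ m') :
    ∑ a ∈ range (m + 1), (m.choose a : ℚ) / ((Q + j + a).choose (a + j) : ℚ)
      ≤ ∑ a ∈ range (m' + 1), (m'.choose a : ℚ) / ((Q + j + a).choose (a + j) : ℚ) := by
  induction m', h using Nat.le_induction with
  | base => exact le_rfl
  | succ m' _ ih =>
    refine ih.trans ?_
    rw [rhatSliceSum_succ]
    exact le_add_of_nonneg_right (Finset.sum_nonneg (fun a _ => by positivity))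

/-- **`S_{j+1}(Q, m) ≤ S_j(Q, m)`** (the slice step `slice_sum_step`). -/
lemma slice_anti_j (Q m j : ℕ) :
    ∑ a ∈ range (m + 1), (m.choose a : ℚ) / ((Q + (j + 1) + a).choose (a + (j + 1)) : ℚ)
      ≤ ∑ a ∈ range (m + 1), (m.choose a : ℚ) / ((Q + j + a).choose (a + j) : ℚ) := by
  rw [slice_sum_step]
  exact sub_le_self _ (mul_nonneg (by positivity) (Finset.sum_nonneg (fun a _ => by positivity)))

/-- **`S_j(Q, m) ≤ S₃(Q, m)` for every `j ≥ 3`.** -/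
lemma slice_le_three (Q m j : ℕ) (hj : 3 ≤ j) :
    ∑ a ∈ range (m + 1), (m.choose a : ℚ) / ((Q + j + a).choose (a + j) : ℚ)
      ≤ ∑ a ∈ range (m + 1), (m.choose a : ℚ) / ((Q + 3 + a).choose (a + 3) : ℚ) := by
  induction j, hj using Nat.le_induction with
  | base => exact le_rfl
  | succ j _ ih => exact (slice_anti_j Q m j).trans ih

/-! ### §3 The Wallis upper bound in the two forms used -/

/-- `X_Q² ≤ 4Q` for `X_Q = 4^Q/C(2Q, Q)`, `Q ≥ 1` (`centralBinom_sq_mul_ge`). -/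
lemma xq_sq_le (Q : ℕ) (hQ : 1 ≤ Q) :
    ((4 : ℚ) ^ Q / ((2 * Q).choose Q : ℚ)) ^ 2 ≤ 4 * Q := by
  have h := centralBinom_sq_mul_ge Q hQ
  rw [Nat.centralBinom_eq_two_mul_choose] at h
  have hC : (0 : ℚ) < ((2 * Q).choose Q : ℚ) := by exact_mod_cast Nat.choose_pos (by omega)
  have h' : (16 : ℚ) ^ Q ≤ ((2 * Q).choose Q : ℚ) ^ 2 * (4 * Q) := by exact_mod_cast h
  rw [div_pow, div_le_iff₀ (by positivity), show ((4 : ℚ) ^ Q) ^ 2 = (16 : ℚ) ^ Q by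
    rw [← pow_mul, pow_mul']; norm_num]
  linarith [h']

/-- **`S₃(Q, Q) ≤ 1/Q`** for `Q ≥ 1`: `3XQ(Q+1) ≤ (Q+2)(2Q+1)(2Q+3)` by `X² ≤ 4Q`. -/
lemma slice_three_diag_le (Q : ℕ) (hQ : 1 ≤ Q) :
    ∑ a ∈ range (Q + 1), (Q.choose a : ℚ) / ((Q + 3 + a).choose (a + 3) : ℚ) ≤ 1 / Q := by
  rw [slice_three_diag]
  have hX2 := xq_sq_le Q hQ
  have hX0 : (0 : ℚ) ≤ (4 : ℚ) ^ Q / ((2 * Q).choose Q : ℚ) := by positivity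
  have hQ' : (1 : ℚ) ≤ Q := by exact_mod_cast hQ
  set X := (4 : ℚ) ^ Q / ((2 * Q).choose Q : ℚ) with hX
  have key : 3 * X * Q * (Q + 1) ≤ (Q + 2) * (2 * Q + 1) * (2 * Q + 3) := by
    have hpoly : (0 : ℚ) ≤ 16 * (Q : ℚ) ^ 6 + 92 * (Q : ℚ) ^ 5 + 336 * (Q : ℚ) ^ 4 + 620 * (Q : ℚ) ^ 3
        + 553 * (Q : ℚ) ^ 2 + 228 * Q + 36 := by positivity
    have h1 : (3 * X * Q * (Q + 1)) ^ 2 ≤ ((Q + 2) * (2 * Q + 1) * (2 * Q + 3)) ^ 2 := by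
      have e : ((Q + 2) * (2 * Q + 1) * (2 * Q + 3)) ^ 2 - 36 * (Q : ℚ) ^ 3 * (Q + 1) ^ 2
          = 16 * (Q : ℚ) ^ 6 + 92 * (Q : ℚ) ^ 5 + 336 * (Q : ℚ) ^ 4 + 620 * (Q : ℚ) ^ 3
            + 553 * (Q : ℚ) ^ 2 + 228 * Q + 36 := by ring
      have h2 : (3 * X * Q * (Q + 1)) ^ 2 ≤ 36 * (Q : ℚ) ^ 3 * (Q + 1) ^ 2 := by
        have : (3 * X * Q * (Q + 1)) ^ 2 = 9 * X ^ 2 * (Q * (Q + 1)) ^ 2 := by ring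
        rw [this]
        have hq0 : (0 : ℚ) ≤ (Q * (Q + 1)) ^ 2 := by positivity
        calc 9 * X ^ 2 * (Q * (Q + 1)) ^ 2 ≤ 9 * (4 * Q) * (Q * (Q + 1)) ^ 2 := by gcongr
          _ = 36 * (Q : ℚ) ^ 3 * (Q + 1) ^ 2 := by ring
      linarith [e, hpoly, h2]
    exact (pow_le_pow_iff_left₀ (by positivity) (by positivity) two_ne_zero).1 h1
  rw [div_add_div _ _ (by positivity) (by positivity), div_le_div_iff₀ (by positivity) (by positivity)]
  nlinarith [key]

/-- With `E² ≤ Q`: **`X_Q · E ≤ 2Q + 1`**, i.e. `X_Q/(2Q+1) ≤ 1/E`. -/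
lemma xq_mul_le (Q E : ℕ) (hQ : 1 ≤ Q) (hE : E ^ 2 ≤ Q) :
    ((4 : ℚ) ^ Q / ((2 * Q).choose Q : ℚ)) * E ≤ 2 * Q + 1 := by
  have hX2 := xq_sq_le Q hQ
  set X := (4 : ℚ) ^ Q / ((2 * Q).choose Q : ℚ) with hX
  have hE' : ((E : ℚ)) ^ 2 ≤ Q := by exact_mod_cast hE
  have h1 : (X * (E : ℚ)) ^ 2 ≤ (2 * (Q : ℚ)) ^ 2 := by
    have hE0 : (0 : ℚ) ≤ (E : ℚ) ^ 2 := by positivity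
    have hQ0 : (0 : ℚ) ≤ (Q : ℚ) := by positivity
    calc (X * (E : ℚ)) ^ 2 = X ^ 2 * (E : ℚ) ^ 2 := by ring
      _ ≤ (4 * (Q : ℚ)) * (Q : ℚ) := mul_le_mul hX2 hE' hE0 (by positivity)
      _ = (2 * (Q : ℚ)) ^ 2 := by ring
  have h2 : X * (E : ℚ) ≤ 2 * (Q : ℚ) :=
    (pow_le_pow_iff_left₀ (by positivity) (by positivity) two_ne_zero).1 h1
  linarith

end PercRepro
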